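import Literature.AlgebraicGeometry.Resolution.WeightedCentreInvariantDirection
import Literature.AlgebraicGeometry.Resolution.WeightedCentreSigmaRescaling
import Mathlib.Algebra.MvPolynomial.Equiv
import Mathlib.RingTheory.MvPolynomial.WeightedHomogeneous
import Mathlib.Algebra.Polynomial.AlgebraMap
import HarnessLib

/-!
# LEMMA L core (c): the vertex step — the top term of a polynomial direction field is an invariant direction
# (instrument, NOT a resolution theorem)

Engine 1 of the RESOLUTION OBSERVATORY toy model `W(f)` (RE-DERIVATION-eng1-g41 §3.7.0, LEMMA L core (c); CARVER-NOTES-eng1-g41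
T89 (c)).  `G ∈ K[ε]`, `K` a domain; `v = (v_j)_j` a DIRECTION FIELD whose entries are polynomials in variables NOT occurring in `G`
(weight them by `ω`, with `ω = 0` on the variables of `G`); suppose the `ω`-top part of `v` is ONE monomial: `v_j = c_j·ε^{γ₀} + (terms of
ω-weight < ω·γ₀)`.  If the one-parameter family of translations `t ↦ (ε_j ↦ ε_j + t·v_j)` fixes `G`, i.e. `G(ε + t·v) = G(ε)` in `K[ε][t]`,
then the top vector `c` is an invariant direction of `G` (`isInvariantDir_of_vertex`; the finite-sum form `isInvariantDir_of_vertex_sum`).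
With `aeval_add_mul_eq_of_isInvariantDir` (an invariant direction may be added to ANY substitution, times anything) the top term can then
be peeled off (`shiftFamily_peel`) and the argument iterated — this is the "lex-leading / vertex" induction of LEMMA L.

Proof (a grading argument, no Hasse derivatives): adjoin `t` as the variable `none` of `MvPolynomial (Option ι) K`
(`MvPolynomial.optionEquivLeft`), weight `t` by `−ω·γ₀`; then `ε_j + t·c_j ε^{γ₀}` is homogeneous of weight `0` and `t·(v_j − c_j ε^{γ₀})`
has only monomials of weight `< 0`, so the weight-`0` component of `G(ε + t·v)` is `G(ε + t·c·ε^{γ₀})`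
(`weightedHomogeneousComponent_aeval_add`); the hypothesis makes it `G`, and `G(ε + tQ·c) = G` with `Q = ε^{γ₀} ≠ 0` forces
`G(ε + t·c) = G` over a domain (`isInvariantDir_of_sigmaScale_lineShift`, cf. `WeightedCentrePolyShift`).
The hypothesis `G(ε + t·v) = G` is written with the raw substitution `MvPolynomial.aeval (fun j => C ε_j + t·C v_j)`; it is
`PolyShift.polyShift v G` of `WeightedCentrePolyShift` by `rfl`.
References: invariant directions / translation-invariance of forms [Lang2002, Ch. IV §1 (polynomials under substitution), Ch. VIII §5];
weighted homogeneous components (Mathlib `MvPolynomial.weightedHomogeneousComponent`); the weighted frame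
[AbramovichTemkinWlodarczyk2024, §5.1 (p. 1575)].  All statements are OURS (toy-model bookkeeping).
-/

namespace Literature.AlgebraicGeometry.Resolution.WeightedBlowup

namespace VertexStep

open MvPolynomial InvariantDirection
open scoped Pointwise

/-! ## Weight bounds on supports -/

section WeightBounds

variable {K : Type*} [CommRing K] {σ : Type*}

/-- `weight` of a pushed-forward exponent vector (ours, bookkeeping). [cite: Lang2002, Ch. IV §1] -/
theorem weight_mapDomain {α β M : Type*} [AddCommMonoid M] (w : β → M) (f : α → β) (d : α →₀ ℕ) :
    Finsupp.weight w (d.mapDomain f) = Finsupp.weight (w ∘ f) d := by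
  simp only [Finsupp.weight_apply]
  exact Finsupp.sum_mapDomain_index (fun _ => zero_smul ℕ _) (fun _ _ _ => add_smul _ _ _)

/-- If every variable of `G` has weight `0`, every monomial of `G` has weight `0` (ours). [cite: Lang2002, Ch. IV §1] -/
theorem weight_eq_zero_of_vars {M : Type*} [AddCommMonoid M] {ω : σ → M} {G : MvPolynomial σ K}
    (hG : ∀ j ∈ G.vars, ω j = 0) (m : σ →₀ ℕ) (hm : m ∈ G.support) : Finsupp.weight ω m = 0 := by
  rw [Finsupp.weight_apply, Finsupp.sum]
  refine Finset.sum_eq_zero fun i hi => ?_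
  rw [hG i ((MvPolynomial.mem_vars_iff_mem_support i).mpr ⟨m, hm, hi⟩), smul_zero]

variable (wt : σ → ℤ)

/-- Every monomial of `f` has `wt`-weight `≤ n` (ours, bookkeeping predicate). [cite: Lang2002, Ch. IV §1] -/
def WtLE (n : ℤ) (f : MvPolynomial σ K) : Prop := ∀ m ∈ f.support, Finsupp.weight wt m ≤ n

/-- Every monomial of `f` has `wt`-weight `< n` (ours, bookkeeping predicate). [cite: Lang2002, Ch. IV §1] -/
def WtLT (n : ℤ) (f : MvPolynomial σ K) : Prop := ∀ m ∈ f.support, Finsupp.weight wt m < n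

variable {wt}

/-- Homogeneous of weight `n` ⇒ weights `≤ n` (ours, bookkeeping). [cite: Lang2002, Ch. IV §1] -/
theorem wtLE_of_isWeightedHomogeneous {n : ℤ} {f : MvPolynomial σ K} (h : IsWeightedHomogeneous wt f n) : WtLE wt n f :=
  fun _ hm => (h (mem_support_iff.mp hm)).le

/-- `< n` ⇒ `≤ n` (ours, bookkeeping). [cite: Lang2002, Ch. IV §1] -/
theorem WtLT.wtLE {n : ℤ} {f : MvPolynomial σ K} (h : WtLT wt n f) : WtLE wt n f := fun m hm => (h m hm).le

/-- `0` has no monomials (ours, bookkeeping). [cite: Lang2002, Ch. IV §1] -/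
theorem wtLT_zero (n : ℤ) : WtLT wt n (0 : MvPolynomial σ K) := fun m hm => by simp at hm

/-- Constants have weight `0 ≤ n` (ours, bookkeeping). [cite: Lang2002, Ch. IV §1] -/
theorem wtLE_C (r : K) {n : ℤ} (hn : 0 ≤ n) : WtLE wt n (C r : MvPolynomial σ K) := by
  classical
  intro m hm
  rw [mem_support_iff, coeff_C] at hm
  split_ifs at hm with h
  · subst h; simpa using hn
  · exact absurd rfl hm

variable [DecidableEq σ]

/-- Weight bounds are stable under `+` (ours, bookkeeping). [cite: Lang2002, Ch. IV §1] -/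
theorem WtLE.add {n : ℤ} {f g : MvPolynomial σ K} (hf : WtLE wt n f) (hg : WtLE wt n g) : WtLE wt n (f + g) := by
  intro m hm
  rcases Finset.mem_union.mp (support_add hm) with h | h
  exacts [hf m h, hg m h]

/-- Strict weight bounds are stable under `+` (ours, bookkeeping). [cite: Lang2002, Ch. IV §1] -/
theorem WtLT.add {n : ℤ} {f g : MvPolynomial σ K} (hf : WtLT wt n f) (hg : WtLT wt n g) : WtLT wt n (f + g) := by
  intro m hm
  rcases Finset.mem_union.mp (support_add hm) with h | h
  exacts [hf m h, hg m h]

/-- Weights add under multiplication: `≤ n` times `≤ n'` is `≤ n + n'` (ours). [cite: Lang2002, Ch. IV §1] -/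
theorem WtLE.mul {n n' : ℤ} {f g : MvPolynomial σ K} (hf : WtLE wt n f) (hg : WtLE wt n' g) : WtLE wt (n + n') (f * g) := by
  intro m hm
  obtain ⟨a, ha, b, hb, rfl⟩ := Finset.mem_add.mp (support_mul f g hm)
  rw [map_add]
  exact add_le_add (hf a ha) (hg b hb)

/-- `≤ n` times `< n'` is `< n + n'` (ours, bookkeeping). [cite: Lang2002, Ch. IV §1] -/
theorem WtLE.mul_lt {n n' : ℤ} {f g : MvPolynomial σ K} (hf : WtLE wt n f) (hg : WtLT wt n' g) :
    WtLT wt (n + n') (f * g) := by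
  intro m hm
  obtain ⟨a, ha, b, hb, rfl⟩ := Finset.mem_add.mp (support_mul f g hm)
  rw [map_add]
  exact add_lt_add_of_le_of_lt (hf a ha) (hg b hb)

/-- `< n` times `≤ n'` is `< n + n'` (ours, bookkeeping). [cite: Lang2002, Ch. IV §1] -/
theorem WtLT.mul_le {n n' : ℤ} {f g : MvPolynomial σ K} (hf : WtLT wt n f) (hg : WtLE wt n' g) :
    WtLT wt (n + n') (f * g) := by
  intro m hm
  obtain ⟨a, ha, b, hb, rfl⟩ := Finset.mem_add.mp (support_mul f g hm)
  rw [map_add]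
  exact add_lt_add_of_lt_of_le (hf a ha) (hg b hb)

/-- A substitution by values of weight `≤ 0` produces weight `≤ 0` (ours). [cite: Lang2002, Ch. IV §1] -/
theorem wtLE_aeval {τ : Type*} (φ : τ → MvPolynomial σ K) (hφ : ∀ j, WtLE wt 0 (φ j)) (P : MvPolynomial τ K) :
    WtLE wt 0 (aeval φ P) := by
  induction P using MvPolynomial.induction_on with
  | C r => rw [aeval_C, MvPolynomial.algebraMap_eq]; exact wtLE_C r le_rfl
  | add p q hp hq => rw [map_add]; exact hp.add hq
  | mul_X p j hp =>
    rw [map_mul, aeval_X]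
    have h := hp.mul (hφ j)
    rwa [add_zero] at h

omit [DecidableEq σ] in
/-- A substitution by weight-`0` homogeneous values is weight-`0` homogeneous (ours). [cite: Lang2002, Ch. IV §1] -/
theorem isWeightedHomogeneous_aeval_zero {τ : Type*} (a : τ → MvPolynomial σ K) (ha : ∀ j, IsWeightedHomogeneous wt (a j) 0)
    (P : MvPolynomial τ K) : IsWeightedHomogeneous wt (aeval a P) 0 := by
  induction P using MvPolynomial.induction_on with
  | C r => rw [aeval_C, MvPolynomial.algebraMap_eq]; exact isWeightedHomogeneous_C wt r
  | add p q hp hq => rw [map_add]; exact hp.add hq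
  | mul_X p j hp =>
    rw [map_mul, aeval_X]
    have h := hp.mul (ha j)
    rwa [add_zero] at h

/-- **Leading-form principle** (ours): perturbing weight-`0` homogeneous values `a_j` by values `b_j` of weight `< 0` changes
`P(a)` only by terms of weight `< 0`. [cite: Lang2002, Ch. IV §1] -/
theorem wtLT_aeval_add_sub {τ : Type*} (a b : τ → MvPolynomial σ K) (ha : ∀ j, IsWeightedHomogeneous wt (a j) 0)
    (hb : ∀ j, WtLT wt 0 (b j)) (P : MvPolynomial τ K) :
    WtLT wt 0 (aeval (fun j => a j + b j) P - aeval a P) := by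
  induction P using MvPolynomial.induction_on with
  | C r => rw [aeval_C, aeval_C, sub_self]; exact wtLT_zero 0
  | add p q hp hq =>
    have e : aeval (fun j => a j + b j) (p + q) - aeval a (p + q)
        = (aeval (fun j => a j + b j) p - aeval a p) + (aeval (fun j => a j + b j) q - aeval a q) := by
      rw [map_add, map_add]; ring
    rw [e]; exact hp.add hq
  | mul_X p j hp =>
    have e : aeval (fun j => a j + b j) (p * X j) - aeval a (p * X j)
        = (aeval (fun j => a j + b j) p - aeval a p) * a j + aeval (fun j => a j + b j) p * b j := by
      simp only [map_mul, aeval_X]; ring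
    rw [e]
    refine WtLT.add ?_ ?_
    · have h := hp.mul_le (wtLE_of_isWeightedHomogeneous (ha j))
      rwa [add_zero] at h
    · have hP : WtLE wt 0 (aeval (fun j => a j + b j) p) :=
        wtLE_aeval _ (fun j => (wtLE_of_isWeightedHomogeneous (ha j)).add (hb j).wtLE) p
      have h := hP.mul_lt (hb j)
      rwa [add_zero] at h

/-- **The weight-`0` component of `P(a + b)` is `P(a)`** (ours), for `a_j` weight-`0` homogeneous and `b_j` of weight `< 0`.
[cite: Lang2002, Ch. IV §1] -/
theorem weightedHomogeneousComponent_aeval_add {τ : Type*} (a b : τ → MvPolynomial σ K)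
    (ha : ∀ j, IsWeightedHomogeneous wt (a j) 0) (hb : ∀ j, WtLT wt 0 (b j)) (P : MvPolynomial τ K) :
    weightedHomogeneousComponent wt 0 (aeval (fun j => a j + b j) P) = aeval a P := by
  have hsplit : aeval (fun j => a j + b j) P = aeval a P + (aeval (fun j => a j + b j) P - aeval a P) := by ring
  rw [hsplit, map_add, (isWeightedHomogeneous_aeval_zero a ha P).weightedHomogeneousComponent_same,
    weightedHomogeneousComponent_eq_zero' (0 : ℤ) _ (fun d hd => (wtLT_aeval_add_sub a b ha hb P d hd).ne), add_zero]

end WeightBounds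

/-! ## Adjoining the parameter `t` as the variable `none` -/

section OptionWorld

variable {K : Type*} [CommRing K] {ι : Type*}

/-- `optionEquivLeft` sends `rename some q` to the constant `C q` (ours, bookkeeping about Mathlib's `optionEquivLeft`).
[cite: Lang2002, Ch. IV §1] -/
theorem optionEquivLeft_rename_some (q : MvPolynomial ι K) :
    optionEquivLeft K ι (rename some q) = Polynomial.C q := by
  induction q using MvPolynomial.induction_on with
  | C r => rw [rename_C, optionEquivLeft_C]
  | add p q hp hq => rw [map_add, map_add, hp, hq, Polynomial.C_add]
  | mul_X p j hp => rw [map_mul, rename_X, map_mul, hp, optionEquivLeft_X_some, Polynomial.C_mul]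

/-- `optionEquivLeft` turns the substitution `ε_j ↦ ε_j + t·u_j` of `MvPolynomial (Option ι) K` (`t = X none`) into the
one-parameter family `ε_j ↦ C ε_j + t·C u_j` in `K[ε][t]` (ours, bookkeeping; the latter is `PolyShift.polyShift u`).
[cite: Lang2002, Ch. IV §1] -/
theorem optionEquivLeft_aeval (u : ι → MvPolynomial ι K) (P : MvPolynomial ι K) :
    optionEquivLeft K ι (aeval (fun j => X (some j) + X none * rename some (u j)) P)
      = aeval (fun j => Polynomial.C (X j) + Polynomial.X * Polynomial.C (u j)) P := by
  induction P using MvPolynomial.induction_on with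
  | C r =>
    rw [aeval_C, aeval_C, MvPolynomial.algebraMap_eq, optionEquivLeft_C, Polynomial.algebraMap_apply,
      MvPolynomial.algebraMap_eq]
  | add p q hp hq => rw [map_add, map_add, hp, hq, map_add]
  | mul_X p j hp =>
    rw [map_mul, map_mul, hp, aeval_X, map_mul, aeval_X, map_add, map_mul, optionEquivLeft_X_some,
      optionEquivLeft_X_none, optionEquivLeft_rename_some]

/-- The family along `c·Q` factors as `sigmaScale Q ∘ lineShift c` (ours; = `PolyShift.polyShift_C_mul`). [cite: Lang2002, Ch. IV §1] -/
theorem aeval_C_mul_eq_sigmaScale_lineShift (c : ι → K) (Q F : MvPolynomial ι K) :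
    aeval (fun j => Polynomial.C (X j) + Polynomial.X * Polynomial.C (C (c j) * Q)) F = sigmaScale Q (lineShift c F) := by
  have key : aeval (fun j => Polynomial.C (X j) + Polynomial.X * Polynomial.C (C (c j) * Q))
      = ((sigmaScale Q).restrictScalars K).comp (lineShift c) := by
    refine MvPolynomial.algHom_ext fun j => ?_
    simp only [AlgHom.comp_apply, AlgHom.restrictScalars_apply, aeval_X, lineShift_X, map_add, map_mul, sigmaScale_C,
      sigmaScale_X]
    ring
  exact congrArg (fun φ : MvPolynomial ι K →ₐ[K] Polynomial (MvPolynomial ι K) => φ F) key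

/-- Over a domain, `G(ε + tQ·c) = G` with `Q ≠ 0` forces `G(ε + t·c) = G` (ours; = `PolyShift.isInvariantDir_of_polyShift_C_mul`).
[cite: Lang2002, Ch. IV §1] -/
theorem isInvariantDir_of_sigmaScale_lineShift [NoZeroDivisors K] (c : ι → K) {Q : MvPolynomial ι K} (hQ : Q ≠ 0)
    {F : MvPolynomial ι K} (h : sigmaScale Q (lineShift c F) = Polynomial.C F) : IsInvariantDir F c := by
  unfold IsInvariantDir
  refine Polynomial.ext fun n => ?_
  have hn := Polynomial.ext_iff.mp h n
  rw [coeff_sigmaScale, Polynomial.coeff_C] at hn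
  rw [Polynomial.coeff_C]
  rcases Nat.eq_zero_or_pos n with rfl | hpos
  · simpa using hn
  · rw [if_neg hpos.ne'] at hn ⊢
    exact (mul_eq_zero.mp hn).resolve_left (pow_ne_zero n hQ)

end OptionWorld

/-! ## The vertex step -/

section Vertex

variable {K : Type*} [CommRing K] {ι : Type*}

/-- **LEMMA L core (c), the vertex step** (ours; T89 (c)).  `ω = 0` on the variables of `G`; the direction field `v` has top
part `c·ε^{γ₀}`: every monomial of `v_j − c_j ε^{γ₀}` (`j` a variable of `G`) has `ω`-weight `< ω·γ₀`; and `G(ε + t·v) = G`.  Then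
`c` is an invariant direction of `G`.  (`K` a domain.) [cite: Lang2002, Ch. IV §1; AbramovichTemkinWlodarczyk2024, §5.1 (p. 1575)] -/
theorem isInvariantDir_of_vertex [DecidableEq ι] [Nontrivial K] [NoZeroDivisors K] (ω : ι → ℤ) {G : MvPolynomial ι K}
    (hG : ∀ j ∈ G.vars, ω j = 0) (v : ι → MvPolynomial ι K) (c : ι → K) (γ₀ : ι →₀ ℕ)
    (hv : ∀ j ∈ G.vars, WtLT ω (Finsupp.weight ω γ₀) (v j - C (c j) * monomial γ₀ 1))
    (h : aeval (fun j => Polynomial.C (X j) + Polynomial.X * Polynomial.C (v j)) G = Polynomial.C G) :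
    IsInvariantDir G c := by
  classical
  set W : ℤ := Finsupp.weight ω γ₀ with hWdef
  let wt : Option ι → ℤ := fun o => o.elim (-W) ω
  have hcomp : (wt ∘ some) = ω := rfl
  let Q : MvPolynomial ι K := monomial γ₀ 1
  have hQ : Q ≠ 0 := monomial_eq_zero.not.mpr one_ne_zero
  let a : ι → MvPolynomial (Option ι) K := fun j =>
    if j ∈ G.vars then X (some j) + X none * rename some (C (c j) * Q) else 0
  let b : ι → MvPolynomial (Option ι) K := fun j =>
    if j ∈ G.vars then X none * rename some (v j - C (c j) * Q) else 0
  -- (1) `a_j` is homogeneous of weight 0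
  have ha : ∀ j, IsWeightedHomogeneous wt (a j) 0 := by
    intro j
    by_cases hj : j ∈ G.vars
    · simp only [a, if_pos hj]
      refine IsWeightedHomogeneous.add ?_ ?_
      · have h1 := isWeightedHomogeneous_X (R := K) wt (some j)
        have e : wt (some j) = 0 := hG j hj
        rwa [e] at h1
      · rw [map_mul, rename_C, rename_monomial]
        have h2 : IsWeightedHomogeneous wt (monomial (Finsupp.mapDomain some γ₀) (1 : K)) W := by
          refine isWeightedHomogeneous_monomial wt _ _ ?_
          rw [weight_mapDomain, hcomp]
        have h3 := (isWeightedHomogeneous_X (R := K) wt none).mul (h2.C_mul (c j))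
        have e : wt none + W = 0 := by show -W + W = 0; ring
        rwa [e] at h3
    · simp only [a, if_neg hj]
      exact isWeightedHomogeneous_zero _ _ _
  -- (2) `b_j` has only monomials of weight < 0
  have hb : ∀ j, WtLT wt 0 (b j) := by
    intro j
    by_cases hj : j ∈ G.vars
    · simp only [b, if_pos hj]
      have h1 : WtLE wt (-W) (X none : MvPolynomial (Option ι) K) :=
        wtLE_of_isWeightedHomogeneous (isWeightedHomogeneous_X (R := K) wt none)
      have h2 : WtLT wt W (rename some (v j - C (c j) * Q)) := by
        intro m hm
        rw [support_rename_of_injective (Option.some_injective ι)] at hm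
        obtain ⟨m', hm', rfl⟩ := Finset.mem_image.mp hm
        rw [weight_mapDomain, hcomp]
        exact hv j hj m' hm'
      have h3 := h1.mul_lt h2
      have e : -W + W = 0 := by ring
      rwa [e] at h3
    · simp only [b, if_neg hj]
      exact wtLT_zero 0
  -- (3) on `G`, the substitution `a + b` is the family `ε_j ↦ ε_j + t·v_j`
  have hφ : aeval (fun j => a j + b j) G = aeval (fun j => X (some j) + X none * rename some (v j)) G := by
    have key := MvPolynomial.hom_congr_vars (f₁ := (aeval (fun j => a j + b j)).toRingHom)
      (f₂ := (aeval (fun j => X (some j) + X none * rename some (v j)) : MvPolynomial ι K →ₐ[K] _).toRingHom)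
      (p₁ := G) (p₂ := G) (by ext r; simp)
      (fun j hj _ => by
        simp only [AlgHom.toRingHom_eq_coe, RingHom.coe_coe, aeval_X, a, b, if_pos hj, map_sub]
        ring) rfl
    simpa only [AlgHom.toRingHom_eq_coe, RingHom.coe_coe] using key
  -- (4) the hypothesis, transported: `G(ε + t·v) = G` in `MvPolynomial (Option ι) K`
  have hE : aeval (fun j => X (some j) + X none * rename some (v j)) G = rename some G := by
    apply (optionEquivLeft K ι).injective
    rw [optionEquivLeft_aeval, optionEquivLeft_rename_some, h]
  -- (5) `G` itself is homogeneous of weight 0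
  have hRG : IsWeightedHomogeneous wt (rename some G) 0 := by
    intro d hd
    have hd' : d ∈ (rename some G).support := mem_support_iff.mpr hd
    rw [support_rename_of_injective (Option.some_injective ι)] at hd'
    obtain ⟨m, hm, rfl⟩ := Finset.mem_image.mp hd'
    rw [weight_mapDomain, hcomp]
    exact weight_eq_zero_of_vars hG m hm
  -- (6) take weight-0 components: `G(ε + t·c·Q) = G`
  have hA : aeval a G = rename some G := by
    have hc := weightedHomogeneousComponent_aeval_add a b ha hb G
    rw [hφ, hE, hRG.weightedHomogeneousComponent_same] at hc
    exact hc.symm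
  have hA' : aeval (fun j => X (some j) + X none * rename some (C (c j) * Q)) G = rename some G := by
    rw [← hA]
    have key := MvPolynomial.hom_congr_vars
      (f₁ := (aeval (fun j => X (some j) + X none * rename some (C (c j) * Q)) : MvPolynomial ι K →ₐ[K] _).toRingHom)
      (f₂ := (aeval a).toRingHom) (p₁ := G) (p₂ := G) (by ext r; simp)
      (fun j hj _ => by simp only [AlgHom.toRingHom_eq_coe, RingHom.coe_coe, aeval_X, a, if_pos hj]) rfl
    simpa only [AlgHom.toRingHom_eq_coe, RingHom.coe_coe] using key
  -- (7) back in `K[ε][t]`: `sigmaScale Q (lineShift c G) = C G`, and conclude over the domain `K`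
  have h7 : sigmaScale Q (lineShift c G) = Polynomial.C G := by
    rw [← aeval_C_mul_eq_sigmaScale_lineShift, ← optionEquivLeft_aeval, hA', optionEquivLeft_rename_some]
  exact isInvariantDir_of_sigmaScale_lineShift c hQ h7

/-- **The vertex step, finite-sum form** (ours; T89 (c) as the engine states it): `v_j = Σ_{γ ∈ Γ} θ_γ(j)·ε^γ` with `Γ` finite,
`γ₀ ∈ Γ` the unique `ω`-heaviest exponent (`ω = 0` on the variables of `G`), and `G(ε + t·v) = G`; then `θ_{γ₀}` is an invariant
direction of `G`.  For a lex-leading `γ₀` take `ω` = a lex-compatible weight on the finitely many `γ ∈ Γ`.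
[cite: Lang2002, Ch. IV §1; AbramovichTemkinWlodarczyk2024, §5.1 (p. 1575)] -/
theorem isInvariantDir_of_vertex_sum [DecidableEq ι] [Nontrivial K] [NoZeroDivisors K] (ω : ι → ℤ) {G : MvPolynomial ι K}
    (hG : ∀ j ∈ G.vars, ω j = 0) (Γ : Finset (ι →₀ ℕ)) (θ : (ι →₀ ℕ) → ι → K) {γ₀ : ι →₀ ℕ} (hγ₀ : γ₀ ∈ Γ)
    (htop : ∀ γ ∈ Γ, γ ≠ γ₀ → Finsupp.weight ω γ < Finsupp.weight ω γ₀)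
    (h : aeval (fun j => Polynomial.C (X j) + Polynomial.X * Polynomial.C (∑ γ ∈ Γ, C (θ γ j) * monomial γ 1)) G
      = Polynomial.C G) :
    IsInvariantDir G (θ γ₀) := by
  classical
  refine isInvariantDir_of_vertex ω hG _ (θ γ₀) γ₀ (fun j _ => ?_) h
  have e : (∑ γ ∈ Γ, C (θ γ j) * monomial γ (1 : K)) - C (θ γ₀ j) * monomial γ₀ 1
      = ∑ γ ∈ Γ.erase γ₀, C (θ γ j) * monomial γ 1 := by
    rw [← Finset.add_sum_erase Γ _ hγ₀]; ring
  rw [e]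
  intro m hm
  obtain ⟨γ, hγ, hmγ⟩ : ∃ γ ∈ Γ.erase γ₀, m ∈ (C (θ γ j) * monomial γ (1 : K)).support := by
    by_contra hcon
    push Not at hcon
    have : m ∉ (∑ γ ∈ Γ.erase γ₀, C (θ γ j) * monomial γ (1 : K)).support := by
      intro hm'
      obtain ⟨γ, hγ, hmγ⟩ := Finset.mem_biUnion.mp (support_sum hm')
      exact hcon γ hγ hmγ
    exact this hm
  rw [C_mul_monomial, mul_one] at hmγ
  have hm' : m = γ := by
    have := support_monomial_subset hmγ
    simpa using this
  subst hm'
  obtain ⟨hne, hmem⟩ := Finset.mem_erase.mp hγ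
  exact htop m hmem hne

/-! ## Peeling: an invariant direction can be added to any substitution -/

/-- **Base change of an invariant direction** (ours): if `c` is an invariant direction of `G` (`G(ε + t·c) = G`), then for ANY
commutative `K`-algebra `B`, any point `x : ι → B` and any `s ∈ B`, `G(x + s·c) = G(x)`. [cite: Lang2002, Ch. IV §1] -/
theorem aeval_add_mul_eq_of_isInvariantDir {G : MvPolynomial ι K} {c : ι → K} (hc : IsInvariantDir G c)
    {B : Type*} [CommRing B] [Algebra K B] (x : ι → B) (s : B) :
    aeval (fun j => x j + s * algebraMap K B (c j)) G = aeval x G := by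
  let ψ : Polynomial (MvPolynomial ι K) →ₐ[K] B := Polynomial.aevalTower (aeval x) s
  have hψC : ∀ q, ψ (Polynomial.C q) = aeval x q := fun q => Polynomial.aevalTower_C _ _ q
  have hψX : ψ Polynomial.X = s := Polynomial.aevalTower_X _ _
  have key : ψ.comp (lineShift c) = aeval (fun j => x j + s * algebraMap K B (c j)) := by
    refine MvPolynomial.algHom_ext fun j => ?_
    rw [AlgHom.comp_apply, lineShift_X, aeval_X, map_add, map_mul, hψC, hψC, hψX, aeval_X, aeval_C]
  have e := congrArg (fun φ : MvPolynomial ι K →ₐ[K] B => φ G) key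
  simp only [AlgHom.comp_apply] at e
  have hc' : lineShift c G = Polynomial.C G := hc
  rw [← e, hc', hψC]

/-- **Peeling off an invariant top term** (ours): if `c` is an invariant direction of `G`, the family along `v` and the family along
`v − c·Q` agree on `G`, for every `Q`.  With `isInvariantDir_of_vertex` this is the induction of LEMMA L core (c).
[cite: Lang2002, Ch. IV §1] -/
theorem shiftFamily_peel {G : MvPolynomial ι K} {c : ι → K} (hc : IsInvariantDir G c) (v : ι → MvPolynomial ι K)
    (Q : MvPolynomial ι K) :
    aeval (fun j => Polynomial.C (X j) + Polynomial.X * Polynomial.C (v j)) G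
      = aeval (fun j => Polynomial.C (X j) + Polynomial.X * Polynomial.C (v j - C (c j) * Q)) G := by
  have key := aeval_add_mul_eq_of_isInvariantDir hc
    (fun j => Polynomial.C (X j) + Polynomial.X * Polynomial.C (v j - C (c j) * Q)) (Polynomial.X * Polynomial.C Q)
  have e : (fun j => Polynomial.C (X j) + Polynomial.X * Polynomial.C (v j))
      = fun j => (Polynomial.C (X j) + Polynomial.X * Polynomial.C (v j - C (c j) * Q))
          + Polynomial.X * Polynomial.C Q * algebraMap K (Polynomial (MvPolynomial ι K)) (c j) := by
    funext j
    rw [Polynomial.algebraMap_apply, MvPolynomial.algebraMap_eq, map_sub, map_mul]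
    ring
  rw [e]
  exact key

end Vertex

/-! ## Smoke test -/

section Test

/-- Over `ℤ` with slots `Fin 3`: `G = ε₀ − ε₁` (variables `0, 1`, weight `0`), the free variable `ε₂` of weight `1`, the direction
field `v_j = ε₂ + 1` with top term `1·ε₂` (`γ₀ = e₂`, lower term `1` of weight `0 < 1`); `G(ε + t·v) = G`, so the top vector
`c = (1, 1, 1)` is an invariant direction of `G`. -/
example : IsInvariantDir (X 0 - X 1 : MvPolynomial (Fin 3) ℤ) (fun _ => 1) := by
  classical
  refine isInvariantDir_of_vertex (fun j => if j = 2 then 1 else 0) (G := X 0 - X 1) ?_ (fun _ => X 2 + C 1) (fun _ => 1)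
    (Finsupp.single 2 1) ?_ ?_
  · intro j hj
    have h := vars_sub_subset (p := (X 0 : MvPolynomial (Fin 3) ℤ)) (q := X 1) hj
    rw [vars_X, vars_X, Finset.mem_union, Finset.mem_singleton, Finset.mem_singleton] at h
    rcases h with rfl | rfl <;> decide
  · intro j _ m hm
    have e : (X 2 + C 1 : MvPolynomial (Fin 3) ℤ) - C ((fun _ : Fin 3 => (1 : ℤ)) j) * monomial (Finsupp.single 2 1) 1 = C 1 := by
      rw [C_mul_monomial, mul_one]
      show (X 2 + C 1 : MvPolynomial (Fin 3) ℤ) - X 2 = C 1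
      ring
    rw [e, mem_support_iff, coeff_C] at hm
    split_ifs at hm with h0
    · subst h0
      simp [Finsupp.weight_apply]
    · exact absurd rfl hm
  · simp only [map_sub, aeval_X]
    ring

end Test

end VertexStep

end Literature.AlgebraicGeometry.Resolution.WeightedBlowup
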